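import Summits.FinalStateConjecture.FinalStateConjecture.Theses.PhaseMixingCapture
import Literature.Geometry.Lorentzian.TrivialDataAdmissible
import Literature.Geometry.Lorentzian.ModelData

/-!
# Load-bearing hypotheses of the diagonal-surgery lemma (crux `CaptureSuffices`, negative lane)

Drefute findings on STUB 1 `stub_diagonalSurgery` of line `capture-exports-censorship-diagonal-surgery`
(stmt-FinalStateConjecture-9953): the abstract diagonal two-parameter surgery
`Q-generic ∧ Thread ∧ Unfolding ⇒ P-generic` becomes FALSE when the `Q`-genericity hypothesis (the
consumed `WeakCosmicCensorshipMGHD`), the thread hypothesis (STUBS 2–3) or the unfolding-with-repair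
hypothesis (STUB 4) is dropped — each of the three hypotheses is load-bearing. Models: the
singleton class `{trivialData}` on the Minkowski slice (no injective one-parameter family lives in
it, so every family-hypothesis is vacuous while genericity of a property failing at `trivialData` is
false), and the range of the smooth injective family `c ↦ (δ, (c 0) • δ)` (for the third lemma,
built inside the proof, with the parametric bundle plumbing `contMDiff_bilinFamily`). Pure bookkeeping over
`Genericity.lean`; no Theses declaration is asserted.
-/

noncomputable section

-- the problem namespace `FinalStateConjecture.FinalStateConjecture` (single-conjunct summit) trips dupNamespace
set_option linter.dupNamespace false

namespace Summit.FinalStateConjecture.FinalStateConjecture.Theorems.CaptureSuffices.Negative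

open Set Filter Function Topology Bundle
open scoped Manifold ContDiff Topology
open Literature.Geometry.Lorentzian

/-- Two distinct parameters in `ℝ¹`: `EuclideanSpace.single 0 1 ≠ 0`. [folklore] -/
theorem euclideanSpace_single_one_ne_zero :
    (EuclideanSpace.single 0 1 : EuclideanSpace ℝ (Fin 1)) ≠ 0 := fun h0 ↦ by
  simpa using congrArg (fun c : EuclideanSpace ℝ (Fin 1) ↦ c 0) h0

/-- No injective one-parameter family of initial data takes all its values in a singleton class.
[folklore] -/
theorem not_injective_of_forall_mem_singleton {X : Type} [TopologicalSpace X] [ChartedSpace E3 X]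
    [IsManifold (𝓡 3) ∞ X] {d₀ : InitialDataSet (𝓡 3) X}
    {F : EuclideanSpace ℝ (Fin 1) → InitialDataSet (𝓡 3) X}
    (hF : ∀ c, F c ∈ ({d₀} : Set (InitialDataSet (𝓡 3) X))) : ¬ Function.Injective F := by
  intro hinj
  have h : F (EuclideanSpace.single 0 1) = F 0 := by
    rw [mem_singleton_iff.1 (hF _), mem_singleton_iff.1 (hF 0)]
  exact euclideanSpace_single_one_ne_zero (hinj h)

/-- In a singleton admissible class, no property failing at the member is Christodoulou-generic
(codimension `1`): the generic curve would have to be injective inside the singleton. [folklore] -/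
theorem not_isChristodoulouGeneric_singleton {X : Type} [TopologicalSpace X] [ChartedSpace E3 X]
    [IsManifold (𝓡 3) ∞ X] (d₀ : InitialDataSet (𝓡 3) X) {P : InitialDataSet (𝓡 3) X → Prop}
    (hP : ¬ P d₀) : ¬ InitialDataSet.IsChristodoulouGeneric {d₀} P 1 := by
  intro h
  obtain ⟨F, -, -, hinj, hadm, -⟩ := h d₀ ⟨rfl, hP⟩
  exact not_injective_of_forall_mem_singleton hadm hinj

/-- **The diagonal surgery is false without `Q`-genericity** (`stub_diagonalSurgery` of line
`capture-exports-censorship-diagonal-surgery` with its first hypothesis dropped, verbatim otherwise).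
Witness: `X = Minkowski.slice`, `𝓓 = {trivialData}`, `P = Q = False` — the thread hypothesis is
vacuous (`Q` never holds), the unfolding hypothesis is vacuous (no injective family in a singleton),
and `P`-genericity fails at `trivialData`. So the censorship input `W` of the line is load-bearing.
[folklore] -/
theorem diagonalSurgery_false_without_genericity :
    ¬ ∀ (X : Type) [TopologicalSpace X] [ChartedSpace E3 X] [IsManifold (𝓡 3) ∞ X]
        (𝓓 : Set (InitialDataSet (𝓡 3) X)) (P Q : InitialDataSet (𝓡 3) X → Prop),
        (∀ d ∈ 𝓓, Q d → ¬ P d →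
          ∃ F : EuclideanSpace ℝ (Fin 1) → InitialDataSet (𝓡 3) X,
            InitialDataSet.IsSmoothDataFamily 1 F ∧ F 0 = d ∧ Function.Injective F ∧
              (∀ c, F c ∈ 𝓓) ∧ ∀ c, Q (F c)) →
        (∀ F : EuclideanSpace ℝ (Fin 1) → InitialDataSet (𝓡 3) X,
          InitialDataSet.IsSmoothDataFamily 1 F → Function.Injective F → (∀ c, F c ∈ 𝓓) →
            ∃ G : EuclideanSpace ℝ (Fin 2) → InitialDataSet (𝓡 3) X,
              InitialDataSet.IsSmoothDataFamily 2 G ∧ (∀ c : ℝ, G !₂[c, 0] = F !₂[c]) ∧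
                Function.Injective G ∧ (∀ p, G p ∈ 𝓓) ∧
                  ∀ c₀ : ℝ, (∀ᶠ c in 𝓝 c₀, Q (F !₂[c])) →
                    ∃ ε > (0 : ℝ), ∀ᶠ c in 𝓝 c₀, ∀ e : ℝ, e ≠ 0 → |e| < ε → P (G !₂[c, e])) →
        InitialDataSet.IsChristodoulouGeneric 𝓓 P 1 := by
  intro h
  refine not_isChristodoulouGeneric_singleton (X := Minkowski.slice) trivialData
    (P := fun _ ↦ False) not_false ?_
  exact h Minkowski.slice {trivialData} (fun _ ↦ False) (fun _ ↦ False)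
    (fun _ _ hQ _ ↦ hQ.elim)
    (fun _ _ hinj hadm ↦ (not_injective_of_forall_mem_singleton hadm hinj).elim)

/-- **The diagonal surgery is false without the thread hypothesis** (`stub_diagonalSurgery` with
its second hypothesis dropped, verbatim otherwise). Witness: `X = Minkowski.slice`,
`𝓓 = {trivialData}`, `Q = True`, `P = False` — `Q`-genericity holds (empty exceptional set), the
unfolding hypothesis is vacuous, `P`-genericity fails. So the thread through censored non-settling
data (STUBS 2–3 of the line: dilation family, dilation covariance of censorship) is load-bearing.
[folklore] -/
theorem diagonalSurgery_false_without_thread :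
    ¬ ∀ (X : Type) [TopologicalSpace X] [ChartedSpace E3 X] [IsManifold (𝓡 3) ∞ X]
        (𝓓 : Set (InitialDataSet (𝓡 3) X)) (P Q : InitialDataSet (𝓡 3) X → Prop),
        InitialDataSet.IsChristodoulouGeneric 𝓓 Q 1 →
        (∀ F : EuclideanSpace ℝ (Fin 1) → InitialDataSet (𝓡 3) X,
          InitialDataSet.IsSmoothDataFamily 1 F → Function.Injective F → (∀ c, F c ∈ 𝓓) →
            ∃ G : EuclideanSpace ℝ (Fin 2) → InitialDataSet (𝓡 3) X,
              InitialDataSet.IsSmoothDataFamily 2 G ∧ (∀ c : ℝ, G !₂[c, 0] = F !₂[c]) ∧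
                Function.Injective G ∧ (∀ p, G p ∈ 𝓓) ∧
                  ∀ c₀ : ℝ, (∀ᶠ c in 𝓝 c₀, Q (F !₂[c])) →
                    ∃ ε > (0 : ℝ), ∀ᶠ c in 𝓝 c₀, ∀ e : ℝ, e ≠ 0 → |e| < ε → P (G !₂[c, e])) →
        InitialDataSet.IsChristodoulouGeneric 𝓓 P 1 := by
  intro h
  refine not_isChristodoulouGeneric_singleton (X := Minkowski.slice) trivialData
    (P := fun _ ↦ False) not_false ?_
  exact h Minkowski.slice {trivialData} (fun _ ↦ False) (fun _ ↦ True)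
    (InitialDataSet.isChristodoulouGeneric_of_forall (fun _ _ ↦ trivial) 1)
    (fun _ _ hinj hadm ↦ (not_injective_of_forall_mem_singleton hadm hinj).elim)

/-! ### The unfolding hypothesis is load-bearing too (needs a genuinely smooth family) -/

section Plumbing

variable {F : Type*} [NormedAddCommGroup F] [NormedSpace ℝ F]

/-- On an open subset `U` of a normed space the preferred trivialisations of the bundle of bilinear
forms on `T U` are the identity on fibres (pointwise form of the computation inside
`OpensSection.contMDiff_bilinSection`). [folklore] -/
theorem hom_trivializationAt_snd (U : TopologicalSpace.Opens F) (x₀ y : U) (b : F →L[ℝ] F →L[ℝ] ℝ) :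
    ((trivializationAt (F →L[ℝ] F →L[ℝ] ℝ)
      (fun x : U ↦ TangentSpace 𝓘(ℝ, F) x →L[ℝ] TangentSpace 𝓘(ℝ, F) x →L[ℝ] ℝ) x₀)
        ⟨y, b⟩).2 = b := by
  ext v w
  rw [hom_trivializationAt_apply]
  simp only [ContinuousLinearMap.inCoordinates, ContinuousLinearMap.comp_apply]
  rw [OpensSection.symmL_apply, Trivialization.continuousLinearMapAt_apply,
    Trivialization.linearMapAt_apply,
    if_pos (by simpa [hom_trivializationAt_baseSet] using OpensSection.mem_chartAt_source U x₀ y)]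
  change ((trivializationAt (F →L[ℝ] ℝ)
    (fun x : U ↦ TangentSpace 𝓘(ℝ, F) x →L[ℝ] Bundle.Trivial U ℝ x) x₀) ⟨y, b v⟩).2 w = b v w
  rw [hom_trivializationAt_apply]
  simp only [ContinuousLinearMap.inCoordinates, ContinuousLinearMap.comp_apply]
  rw [OpensSection.symmL_apply]
  simp
  rfl

/-- **Parametric sections of the bundle of bilinear forms on `T U`** (`U` open in a normed space):
`p ↦ (p.2, s p)` is `C^n` into the total space as soon as `s : M × U → (F →L F →L ℝ)` is `C^n`.
[folklore] -/
theorem contMDiff_bilinFamily {EM : Type*} [NormedAddCommGroup EM] [NormedSpace ℝ EM] {HM : Type*}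
    [TopologicalSpace HM] {IM : ModelWithCorners ℝ EM HM} {M : Type*} [TopologicalSpace M]
    [ChartedSpace HM M] (U : TopologicalSpace.Opens F) {n : ℕ∞ω}
    (s : M × U → F →L[ℝ] F →L[ℝ] ℝ) (hs : ContMDiff (IM.prod 𝓘(ℝ, F)) 𝓘(ℝ, F →L[ℝ] F →L[ℝ] ℝ) n s) :
    ContMDiff (IM.prod 𝓘(ℝ, F)) (𝓘(ℝ, F).prod 𝓘(ℝ, F →L[ℝ] F →L[ℝ] ℝ)) n
      (fun p : M × U ↦ TotalSpace.mk' (F →L[ℝ] F →L[ℝ] ℝ)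
        (E := fun x : U ↦ TangentSpace 𝓘(ℝ, F) x →L[ℝ] TangentSpace 𝓘(ℝ, F) x →L[ℝ] ℝ)
        p.2 (s p)) := by
  intro p₀
  rw [contMDiffAt_totalSpace]
  refine ⟨contMDiffAt_snd, ?_⟩
  refine (hs p₀).congr_of_eventuallyEq (Filter.Eventually.of_forall fun p ↦ ?_)
  exact hom_trivializationAt_snd U p₀.2 p.2 (s p)

end Plumbing

/-! ### The family `c ↦ (δ, (c 0 + a₀) • δ)` on the Minkowski slice (built inside the proof; no defs) -/

/-- The constant section `a • δ` of the bundle of bilinear forms on the Minkowski slice is smooth.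
[folklore] -/
theorem contMDiff_smul_innerSL_slice (a : ℝ) :
    ContMDiff 𝓘(ℝ, E3) (𝓘(ℝ, E3).prod 𝓘(ℝ, E3 →L[ℝ] E3 →L[ℝ] ℝ)) ∞
      (fun y : Minkowski.slice ↦ TotalSpace.mk' (E3 →L[ℝ] E3 →L[ℝ] ℝ)
        (E := fun x : Minkowski.slice ↦
          TangentSpace 𝓘(ℝ, E3) x →L[ℝ] TangentSpace 𝓘(ℝ, E3) x →L[ℝ] ℝ)
        y (a • (innerSL ℝ (E := E3) : E3 →L[ℝ] E3 →L[ℝ] ℝ))) :=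
  OpensSection.contMDiff_bilinSection Minkowski.slice _ contMDiff_const

/-- The parametric section `(c, y) ↦ (c 0 + a₀) • δ` is jointly smooth (via `contMDiff_bilinFamily`).
[folklore] -/
theorem contMDiff_smul_innerSL_family (a₀ : ℝ) :
    ContMDiff (𝓘(ℝ, EuclideanSpace ℝ (Fin 1)).prod 𝓘(ℝ, E3)) (𝓘(ℝ, E3).prod 𝓘(ℝ, E3 →L[ℝ] E3 →L[ℝ] ℝ)) ∞
      (fun p : EuclideanSpace ℝ (Fin 1) × Minkowski.slice ↦ TotalSpace.mk' (E3 →L[ℝ] E3 →L[ℝ] ℝ)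
        (E := fun x : Minkowski.slice ↦
          TangentSpace 𝓘(ℝ, E3) x →L[ℝ] TangentSpace 𝓘(ℝ, E3) x →L[ℝ] ℝ)
        p.2 ((p.1 0 + a₀) • (innerSL ℝ (E := E3) : E3 →L[ℝ] E3 →L[ℝ] ℝ))) := by
  have hc : ContMDiff (𝓘(ℝ, EuclideanSpace ℝ (Fin 1)).prod 𝓘(ℝ, E3)) 𝓘(ℝ, ℝ) ∞
      (fun p : EuclideanSpace ℝ (Fin 1) × Minkowski.slice ↦ p.1 0 + a₀) := by
    have h1 : ContMDiff 𝓘(ℝ, EuclideanSpace ℝ (Fin 1)) 𝓘(ℝ, ℝ) ∞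
        (fun c : EuclideanSpace ℝ (Fin 1) ↦ c 0 + a₀) :=
      ((contDiff_piLp_apply (p := 2) (i := (0 : Fin 1))).add contDiff_const).contMDiff
    exact h1.comp contMDiff_fst
  exact contMDiff_bilinFamily Minkowski.slice _ (hc.smul contMDiff_const)

/-- `⟪e₀, e₀⟫ = 1` for the first standard basis vector of `E3`. [folklore] -/
theorem inner_single_one_self : @inner ℝ E3 _ (EuclideanSpace.single 0 1) (EuclideanSpace.single 0 1) = 1 := by
  rw [real_inner_self_eq_norm_sq]
  simp

/-- **The diagonal surgery is false without the unfolding hypothesis** (`stub_diagonalSurgery` with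
its third hypothesis dropped, verbatim otherwise). Model: on the Minkowski slice the smooth injective
family `H a₀ c := (δ, (c 0 + a₀) • δ)`, `𝓓 := range (H 0)`, `Q = True`, `P = False`:
`Q`-genericity holds (empty exceptional set); through every `d = H 0 c₁ ∈ 𝓓` passes the smooth
injective thread `H (c₁ 0)` inside `𝓓` (a translate); but `P`-genericity fails, since a generic curve
through `H 0 0` would have to lie in `𝓓` and leave `𝓓`. So the unfolding-with-repair hypothesis
(the shape of STUB 4's conclusion) is load-bearing. [folklore] -/
theorem diagonalSurgery_false_without_unfolding :
    ¬ ∀ (X : Type) [TopologicalSpace X] [ChartedSpace E3 X] [IsManifold (𝓡 3) ∞ X]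
        (𝓓 : Set (InitialDataSet (𝓡 3) X)) (P Q : InitialDataSet (𝓡 3) X → Prop),
        InitialDataSet.IsChristodoulouGeneric 𝓓 Q 1 →
        (∀ d ∈ 𝓓, Q d → ¬ P d →
          ∃ F : EuclideanSpace ℝ (Fin 1) → InitialDataSet (𝓡 3) X,
            InitialDataSet.IsSmoothDataFamily 1 F ∧ F 0 = d ∧ Function.Injective F ∧
              (∀ c, F c ∈ 𝓓) ∧ ∀ c, Q (F c)) →
        InitialDataSet.IsChristodoulouGeneric 𝓓 P 1 := by
  intro h
  -- the datum `(δ, a • δ)` and the family `H a₀ c := (δ, (c 0 + a₀) • δ)`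
  let kD : ℝ → InitialDataSet 𝓘(ℝ, E3) Minkowski.slice := fun a ↦
    { h := Minkowski.flatMetric
      k := fun _ ↦ a • (innerSL ℝ (E := E3) : E3 →L[ℝ] E3 →L[ℝ] ℝ)
      k_symm := fun _ v w ↦ congrArg (fun t : ℝ ↦ a * t) (real_inner_comm (F := E3) w v)
      contMDiff_k := contMDiff_smul_innerSL_slice a }
  let H : ℝ → EuclideanSpace ℝ (Fin 1) → InitialDataSet 𝓘(ℝ, E3) Minkowski.slice :=
    fun a₀ c ↦ kD (c 0 + a₀)
  have Hk : ∀ (a₀ : ℝ) (c : EuclideanSpace ℝ (Fin 1)) (y : Minkowski.slice),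
      (H a₀ c).k y = (c 0 + a₀) • (innerSL ℝ (E := E3) : E3 →L[ℝ] E3 →L[ℝ] ℝ) := fun _ _ _ ↦ rfl
  have Hsmooth : ∀ a₀ : ℝ, InitialDataSet.IsSmoothDataFamily 1 (H a₀) := fun a₀ ↦
    ⟨Minkowski.contMDiff_innerSL_slice.comp contMDiff_snd, contMDiff_smul_innerSL_family a₀⟩
  have Hinj : ∀ a₀ : ℝ, Function.Injective (H a₀) := by
    intro a₀ c c' hcc
    have hk := congrArg (fun D : InitialDataSet 𝓘(ℝ, E3) Minkowski.slice ↦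
      D.k ⟨0, Minkowski.mem_slice 0⟩ (EuclideanSpace.single 0 1) (EuclideanSpace.single 0 1)) hcc
    have hk' : (c 0 + a₀) * @inner ℝ E3 _ (EuclideanSpace.single 0 1) (EuclideanSpace.single 0 1) =
        (c' 0 + a₀) * @inner ℝ E3 _ (EuclideanSpace.single 0 1) (EuclideanSpace.single 0 1) := hk
    rw [inner_single_one_self, mul_one, mul_one] at hk'
    have h0 : c 0 = c' 0 := by linarith
    ext i
    fin_cases i
    exact h0
  have Hshift : ∀ (a₀ : ℝ) (c : EuclideanSpace ℝ (Fin 1)),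
      H 0 (c + EuclideanSpace.single 0 a₀) = H a₀ c := by
    intro a₀ c
    show kD _ = kD _
    congr 1
    simp
  have hgen := h Minkowski.slice (range (H 0)) (fun _ ↦ False) (fun _ ↦ True)
    (InitialDataSet.isChristodoulouGeneric_of_forall (fun _ _ ↦ trivial) 1) ?_
  · obtain ⟨F, -, -, -, hadm, hexc⟩ := hgen (H 0 0) ⟨⟨0, rfl⟩, not_false⟩
    exact hexc _ euclideanSpace_single_one_ne_zero ⟨hadm _, not_false⟩
  · rintro d ⟨c₁, rfl⟩ - -
    refine ⟨H (c₁ 0), Hsmooth _, ?_, Hinj _, fun c ↦ ⟨c + EuclideanSpace.single 0 (c₁ 0), Hshift _ c⟩,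
      fun _ ↦ trivial⟩
    rw [← Hshift]
    congr 1
    ext i; fin_cases i; simp

end Summit.FinalStateConjecture.FinalStateConjecture.Theorems.CaptureSuffices.Negative

end
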